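import Literature.NumberTheory.EllipticCurves.LatticeEndomorphismOfCurve
import HarnessLib

/-!
# The analytic representation of an endomorphism of `E_Λ`: `φ` lifts to `z ↦ αz`

Topic `NumberTheory/EllipticCurves`; a proofs-only file (theorems only, no definitions, no named
facts) in `namespace PeriodPair` (deliberate dot-notation extensions of Mathlib's `PeriodPair`),
sharpening the tree's `LatticeEndomorphismOfCurve.lean`.  That file proves, from an algebraic
endomorphism `φ` of `E_Λ` which is not multiplication by an integer, that `Λ` has complex
multiplication (`PeriodPair.hasCM_of_curve_endomorphism`: *some* `α ∉ ℤ` has `αΛ ⊆ Λ`).  For the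
ring isomorphism `End(E) ≅ End(Λ)` (Silverman, *AEC*, Thm. VI.5.3 with Thm. VI.4.1(b); Cox,
*Primes of the form x² + ny²*, §14.B) one needs the full **analytic representation**: the
endomorphism *is* `z ↦ αz` through the parametrisation `π : ℂ → E_Λ(ℂ)`, `z ↦ (℘ z, ℘' z/2)`.

* `PeriodPair.exists_forall_sub_mul_mem_lattice_of_rational_lift` — the analytic core of that
  file (`hasCM_of_rational_lift`) with its conclusion strengthened and the non-integrality
  hypothesis dropped: a map `Ψ` on a subgroup `G ≤ ℂ` containing the division points of `Λ`,
  additive modulo `Λ` and given off finitely many cosets by rational functions of `(℘, ℘'/2)`, is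
  congruent modulo `Λ` to `z ↦ αz` on **all of `G`**, for some `α ∈ ℂ`.  (Same proof: local
  holomorphic lifts near a generic division point are affine, `F₁(ζ) = αζ + β`
  (`exists_local_lift`, `exists_eq_affine_of_lifts`); additivity gives `Ψ(g) ≡ αg` for small
  `g ∈ G`, and every element of `G` is a small element plus a multiple of a small division point.)
* `PeriodPair.exists_forall_map_eq_toPoint_mul_of_curve_endomorphism` — the same for an abstract
  group `M ↪ E_Λ(ℂ)` (via `f`) whose image contains the torsion and an additive `φ : M → M` which
  is a rational map through `f` off a finite set (the shape in which `End_{ℚ̄}(E)` presents itself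
  in the prelude `Isogeny.lean`): there is `α ∈ ℂ` with `f (φ m) = π (α z)` whenever `f m = π z`
  (Silverman, *AEC*, Thm. VI.4.1(b): "`φ(z) = αz (mod Λ₂)`"; Thm. VI.5.3).
* `PeriodPair.eq_zero_of_forall_div_natCast_mem_lattice` — `δ/n ∈ Λ` for all `n ≥ 1` forces
  `δ = 0` (discreteness), whence the uniqueness of the multiplier
  (`PeriodPair.mul_unique_of_toPoint_mul_eq`).

## References

* J. H. Silverman, *The Arithmetic of Elliptic Curves*, 2nd ed., GTM 106, Springer 2009:
  Thm. VI.4.1(b), Thm. VI.5.3, Prop. VI.3.6(b). [SilvermanAEC2009]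
* D. A. Cox, *Primes of the form x² + ny²*, 2nd ed., Wiley 2013, §14.B (PDF pp. 318–319).
-/

noncomputable section

open Complex Filter Topology Set

namespace PeriodPair

variable (L : PeriodPair)

/-! ### Discreteness: the multiplier is unique -/

/-- If `δ/n ∈ Λ` for every `n ≥ 1` then `δ = 0` (`δ/n → 0` through nonzero values, and `Λ` is
discrete). [folklore] -/
theorem eq_zero_of_forall_div_natCast_mem_lattice {δ : ℂ}
    (h : ∀ n : ℕ, 0 < n → δ / n ∈ L.lattice) : δ = 0 := by
  by_contra hδ
  have ht : Tendsto (fun n : ℕ ↦ δ / n) atTop (𝓝[≠] 0) := by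
    refine tendsto_nhdsWithin_iff.mpr ⟨tendsto_const_div_atTop_nhds_zero_nat δ, ?_⟩
    filter_upwards [eventually_gt_atTop 0] with n hn
    exact div_ne_zero hδ (by exact_mod_cast hn.ne')
  obtain ⟨n, hn⟩ := ((ht.eventually L.eventually_nhdsNE_notMem_lattice).and
    (eventually_gt_atTop 0)).exists
  exact hn.1 (h n hn.2)

/-- **Uniqueness of the multiplier.**  If `G` contains the division points of `Λ` and
`π(αz) = π(βz)` for all `z ∈ G` (`π = toPoint`), then `α = β`. [folklore] -/
theorem mul_unique_of_toPoint_mul_eq {G : AddSubgroup ℂ}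
    (hdiv : ∀ n : ℕ, 0 < n → ∀ l ∈ L.lattice, l / n ∈ G) {α β : ℂ}
    (h : ∀ z ∈ G, L.toPoint (α * z) = L.toPoint (β * z)) : α = β := by
  have hδ : (α - β) * L.ω₁ = 0 := by
    refine L.eq_zero_of_forall_div_natCast_mem_lattice fun n hn ↦ ?_
    have hz := h _ (hdiv n hn _ L.ω₁_mem_lattice)
    have := L.toPoint_eq_toPoint_iff.1 hz
    convert this using 1
    ring
  have hω₁ : L.ω₁ ≠ 0 := fun h0 ↦ L.ω₁_div_two_notMem_lattice (by rw [h0, zero_div]; exact zero_mem _)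
  exact sub_eq_zero.1 ((mul_eq_zero.1 hδ).resolve_right hω₁)

/-! ### The analytic core, with the full conclusion `Ψ ≡ α·` on `G` -/

/-- **An additive map that is rational in `(℘, ℘')` is `z ↦ αz` modulo `Λ`.**  Let `G ≤ ℂ`
contain all division points of `Λ`, and let `Ψ : G → ℂ` be additive modulo `Λ` and, off
finitely many cosets `T + Λ`, be given through `℘` by rational functions of `(℘(z), ℘'(z)/2)`:
`℘(Ψ z) = (p₁/q₁)(℘ z, ℘' z/2)`, `℘'(Ψ z)/2 = (p₂/q₂)(℘ z, ℘' z/2)` (with `Ψ z` off `Λ` and off the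
`2`-division points).  Then for some `α ∈ ℂ`, `Ψ z ≡ αz (mod Λ)` for **every** `z ∈ G`.
This is Silverman, *AEC*, Thm. VI.4.1(b) ("`φ(z) = αz (mod Λ₂)`") in the local form of the tree's
`PeriodPair.hasCM_of_rational_lift`, whose proof is followed verbatim through the affineness of
the local lift (`exists_local_lift`, `exists_eq_affine_of_lifts`); the last step spreads
`Ψ(g) ≡ αg` from small `g ∈ G` to all of `G`. [cite: SilvermanAEC2009, Thm. VI.4.1(b)] -/
theorem exists_forall_sub_mul_mem_lattice_of_rational_lift (G : AddSubgroup ℂ)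
    (hdiv : ∀ n : ℕ, 0 < n → ∀ l ∈ L.lattice, l / n ∈ G)
    (Ψ : ℂ → ℂ) (hadd : ∀ z ∈ G, ∀ w ∈ G, Ψ (z + w) - Ψ z - Ψ w ∈ L.lattice)
    (p₁ q₁ p₂ q₂ : MvPolynomial (Fin 2) ℂ) (T : Finset ℂ)
    (hrat : ∀ z ∈ G, (∀ t ∈ T, z - t ∉ L.lattice) →
      z ∉ L.lattice ∧ Ψ z ∉ L.lattice ∧ ℘'[L] (Ψ z) ≠ 0 ∧
      MvPolynomial.eval ![℘[L] z, ℘'[L] z / 2] q₁ ≠ 0 ∧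
      MvPolynomial.eval ![℘[L] z, ℘'[L] z / 2] q₂ ≠ 0 ∧
      ℘[L] (Ψ z) = MvPolynomial.eval ![℘[L] z, ℘'[L] z / 2] p₁ /
        MvPolynomial.eval ![℘[L] z, ℘'[L] z / 2] q₁ ∧
      ℘'[L] (Ψ z) / 2 = MvPolynomial.eval ![℘[L] z, ℘'[L] z / 2] p₂ /
        MvPolynomial.eval ![℘[L] z, ℘'[L] z / 2] q₂) :
    ∃ α : ℂ, ∀ z ∈ G, Ψ z - α * z ∈ L.lattice := by
  have hopen : IsOpen ((L.lattice : Set ℂ)ᶜ) := L.isClosed_lattice.isOpen_compl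
  -- the coordinate functions `(℘, ℘'/2)` and the four functions `p_i(℘, ℘'/2)`, `q_i(℘, ℘'/2)`
  set v : ℂ → Fin 2 → ℂ := fun z ↦ ![℘[L] z, ℘'[L] z / 2] with hv
  have hvan : ∀ z ∉ L.lattice, ∀ i, AnalyticAt ℂ (fun z ↦ v z i) z := by
    intro z hz i
    fin_cases i
    · simpa [hv] using L.analyticOnNhd_weierstrassP z hz
    · have h2 : AnalyticAt ℂ (fun x ↦ ℘'[L] x / 2) z :=
        (L.analyticOnNhd_derivWeierstrassP z hz).div_const
      simpa [hv] using h2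
  have han : ∀ p : MvPolynomial (Fin 2) ℂ,
      AnalyticOnNhd ℂ (fun z ↦ MvPolynomial.eval (v z) p) (L.lattice : Set ℂ)ᶜ := by
    intro p z hz
    have := AnalyticAt.aeval_mvPolynomial (hvan z hz) p
    simpa only [MvPolynomial.aeval_eq_eval] using this
  set N₁ : ℂ → ℂ := fun z ↦ MvPolynomial.eval (v z) p₁ with hN₁
  set D₁ : ℂ → ℂ := fun z ↦ MvPolynomial.eval (v z) q₁ with hD₁
  set N₂ : ℂ → ℂ := fun z ↦ MvPolynomial.eval (v z) p₂ with hN₂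
  set D₂ : ℂ → ℂ := fun z ↦ MvPolynomial.eval (v z) q₂ with hD₂
  -- the bad cosets and the open set `U`
  set Bset : Set ℂ := {z | ∃ t ∈ T, z - t ∈ L.lattice} with hBset
  have hBclosed : IsClosed Bset := by
    have : Bset = ⋃ t ∈ (T : Set ℂ), (fun z ↦ z - t) ⁻¹' (L.lattice : Set ℂ) := by
      ext z; simp [hBset]
    rw [this]
    exact T.finite_toSet.isClosed_biUnion fun t _ ↦ L.isClosed_lattice.preimage (by fun_prop)
  have hgood : ∀ z, z ∉ Bset → ∀ t ∈ T, z - t ∉ L.lattice :=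
    fun z hz t ht hmem ↦ hz ⟨t, ht, hmem⟩
  set U : Set ℂ := {z | z ∉ L.lattice ∧ D₁ z ≠ 0 ∧ D₂ z ≠ 0 ∧ z ∉ Bset} with hU
  have hUopen : IsOpen U := by
    rw [isOpen_iff_mem_nhds]
    rintro z ⟨hz, hz₁, hz₂, hzB⟩
    have e1 : ∀ᶠ w in 𝓝 z, D₁ w ≠ 0 := (han q₁ z hz).continuousAt.eventually_ne hz₁
    have e2 : ∀ᶠ w in 𝓝 z, D₂ w ≠ 0 := (han q₂ z hz).continuousAt.eventually_ne hz₂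
    filter_upwards [hopen.mem_nhds hz, e1, e2, hBclosed.isOpen_compl.mem_nhds hzB]
      with w h0 h1 h2 h3 using ⟨h0, h1, h2, h3⟩
  set R : ℂ → ℂ := fun z ↦ N₁ z / D₁ z with hR
  set K : ℂ → ℂ := fun z ↦ N₂ z / D₂ z with hK
  have hRd : DifferentiableOn ℂ R U := fun z hz ↦
    (((han p₁ z hz.1).differentiableAt).div (han q₁ z hz.1).differentiableAt
      hz.2.1).differentiableWithinAt
  have hKc : ContinuousOn K U := fun z hz ↦
    (((han p₂ z hz.1).continuousAt).div (han q₂ z hz.1).continuousAt hz.2.2.1).continuousWithinAt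
  have hΨU : ∀ z ∈ U, z ∈ (G : Set ℂ) →
      Ψ z ∉ L.lattice ∧ ℘[L] (Ψ z) = R z ∧ ℘'[L] (Ψ z) / 2 = K z := by
    intro z hz hzG
    obtain ⟨-, h1, -, -, -, h2, h3⟩ := hrat z hzG (hgood z hz.2.2.2)
    exact ⟨h1, h2, h3⟩
  -- Step 1: a generic division point `a`
  obtain ⟨n, hn, hgood₁, hgood₂⟩ := L.exists_generic_div_point T
  set a : ℂ := L.ω₁ / n with hadef
  have haG : a ∈ G := hdiv n hn _ L.ω₁_mem_lattice
  have haB : a ∉ Bset := fun ⟨t, ht, h⟩ ↦ hgood₁ t ht h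
  have haaB : a + a ∉ Bset := fun ⟨t, ht, h⟩ ↦ hgood₂ t ht h
  obtain ⟨ha1, -, ha3, ha4, ha5, -, -⟩ := hrat a haG (hgood a haB)
  obtain ⟨haa1, -, haa3, haa4, haa5, -, -⟩ := hrat (a + a) (G.add_mem haG haG) (hgood _ haaB)
  have haU : a ∈ U := ⟨ha1, ha4, ha5, haB⟩
  have haaU : a + a ∈ U := ⟨haa1, haa4, haa5, haaB⟩
  -- Step 2: local holomorphic lifts near `a` and `2a`
  obtain ⟨ε₁, hε₁, F₁, -, hF₁d, -, hF₁Ψ⟩ :=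
    L.exists_local_lift hUopen haU haG hRd hKc hΨU ha3
  obtain ⟨ε₂, hε₂, F₂, -, hF₂d, -, hF₂Ψ⟩ :=
    L.exists_local_lift hUopen haaU (G.add_mem haG haG) hRd hKc hΨU haa3
  -- Step 3: the lift near `a` is affine
  have hdense : Dense (G : Set ℂ) := dense_of_div_mem hdiv
  obtain ⟨α, β, ε, hε, hεle, haff⟩ :=
    L.exists_eq_affine_of_lifts hdense hadd haG hε₁ hε₂ hF₁d hF₂d hF₁Ψ hF₂Ψ
  -- Step 4: `Ψ ≡ α·` on `G`
  refine ⟨α, fun z hzG ↦ ?_⟩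
  -- small elements of `G`
  have hsmall : ∀ g ∈ G, ‖g‖ < ε → Ψ g - α * g ∈ L.lattice := by
    intro g hg hgε
    have hag : a + g ∈ Metric.ball a ε := by
      simpa [Metric.mem_ball, dist_eq_norm] using hgε
    have h1 := hF₁Ψ (a + g) (Metric.ball_subset_ball hεle hag) (G.add_mem haG hg)
    have h2 := hF₁Ψ a (Metric.mem_ball_self hε₁) haG
    have h3 := hadd a haG g hg
    have e : Ψ g - α * g =
        -(Ψ (a + g) - Ψ a - Ψ g) - (F₁ (a + g) - Ψ (a + g)) + (F₁ a - Ψ a) := by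
      rw [haff (a + g) hag, haff a (Metric.mem_ball_self hε)]
      ring
    rw [e]
    exact add_mem (sub_mem (neg_mem h3) h1) h2
  -- a general element of `G` is a small element plus a multiple of a small division point
  obtain ⟨N, l, hN, hl, hzl⟩ := L.exists_norm_sub_div_lt z hε
  obtain ⟨m', hm'⟩ := exists_nat_gt (‖l / N‖ / ε)
  have hm'pos : (0 : ℝ) < m' := lt_of_le_of_lt (by positivity) hm'
  have hm'0 : 0 < m' := by exact_mod_cast hm'pos
  have hN0 : (N : ℂ) ≠ 0 := by exact_mod_cast hN.ne'
  have hm'c : (m' : ℂ) ≠ 0 := by exact_mod_cast hm'0.ne'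
  set g₂ : ℂ := l / ((N * m' : ℕ) : ℂ) with hg₂
  have hg₂G : g₂ ∈ G := hdiv (N * m') (Nat.mul_pos hN hm'0) l hl
  have hmg₂ : (m' : ℂ) * g₂ = l / N := by
    rw [hg₂, Nat.cast_mul]; field_simp
  set g₁ : ℂ := z - m' * g₂ with hg₁
  have hg₁G : g₁ ∈ G := G.sub_mem hzG (by rw [hmg₂]; exact hdiv N hN l hl)
  have hg₁ε : ‖g₁‖ < ε := by rwa [hg₁, hmg₂]
  have hg₂ε : ‖g₂‖ < ε := by
    have e : g₂ = (l / N) / m' := by rw [← hmg₂]; field_simp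
    rw [e, norm_div, Complex.norm_natCast, div_lt_iff₀ hm'pos]
    rwa [div_lt_iff₀ hε, mul_comm] at hm'
  have h1 := hsmall g₁ hg₁G hg₁ε
  have h2 := hsmall g₂ hg₂G hg₂ε
  have h3 := sub_nsmul_mem_of_add hadd hg₂G m'
  have h4 := hadd g₁ hg₁G (m' * g₂) (by simpa using G.nsmul_mem hg₂G m')
  have e : Ψ z - α * z = (Ψ (g₁ + m' * g₂) - Ψ g₁ - Ψ (m' * g₂)) + (Ψ g₁ - α * g₁) +
      (Ψ (m' * g₂) - m' * Ψ g₂) + m' * (Ψ g₂ - α * g₂) := by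
    rw [hg₁]; ring_nf
  rw [e]
  refine add_mem (add_mem (add_mem h4 h1) h3) ?_
  simpa [nsmul_eq_mul] using nsmul_mem h2 m'

/-! ### From an endomorphism of the curve `E_Λ` -/

/-- **The analytic representation of an endomorphism of `E_Λ`** (Silverman, *AEC*, Thm. VI.4.1(b)
with Thm. VI.5.3: a holomorphic homomorphism `ℂ/Λ → ℂ/Λ` is `z ↦ αz`; Cox, *Primes of the form
x² + ny²*, §14.B: `End_ℂ(E) = {α ∈ ℂ : αL ⊂ L}`), in the elementary form of the tree's
`PeriodPair.hasCM_of_curve_endomorphism`.  Let `M` be an abstract group mapped injectively into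
`E_Λ(ℂ)` by `f` with image containing all torsion points, and let `φ : M →+ M` be an additive
map which, through `f`, is given off a finite set by a rational map `(x, y) ↦ (p₁/q₁, p₂/q₂)(x, y)`.
Then there is `α ∈ ℂ` such that `f (φ m) = π (α z)` whenever `f m = π z`, where
`π : ℂ → E_Λ(ℂ)`, `z ↦ (℘ z, ℘' z/2)` is the analytic parametrisation (`PeriodPair.toPoint`).
(Apply the previous theorem to `G = π⁻¹(f(M))` and a lift `Ψ` of `f ∘ φ ∘ f⁻¹ ∘ π` through `π`,
exactly as in `hasCM_of_curve_endomorphism`.) [cite: SilvermanAEC2009, Thm. VI.4.1(b) and Thm. VI.5.3] -/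
theorem exists_forall_map_eq_toPoint_mul_of_curve_endomorphism {M : Type*} [AddCommGroup M]
    (φ : M →+ M) (f : M →+ L.curve.toAffine.Point)
    (hf : Function.Injective f) (p₁ q₁ p₂ q₂ : MvPolynomial (Fin 2) ℂ)
    (halg : {m : M | ¬ ∃ (x y : ℂ) (h : L.curve.toAffine.Nonsingular x y),
        f m = .some x y h ∧ MvPolynomial.eval ![x, y] q₁ ≠ 0 ∧ MvPolynomial.eval ![x, y] q₂ ≠ 0 ∧
        ∃ h' : L.curve.toAffine.Nonsingular
            (MvPolynomial.eval ![x, y] p₁ / MvPolynomial.eval ![x, y] q₁)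
            (MvPolynomial.eval ![x, y] p₂ / MvPolynomial.eval ![x, y] q₂),
          f (φ m) = .some _ _ h'}.Finite)
    (htors : ∀ n : ℕ, 0 < n → ∀ P : L.curve.toAffine.Point, n • P = 0 → P ∈ f.range) :
    ∃ α : ℂ, ∀ (m : M) (z : ℂ), f m = L.toPoint z → f (φ m) = L.toPoint (α * z) := by
  classical
  set π : ℂ →+ L.curve.toAffine.Point := toPointHom (toPoint_add_holds (L := L)) with hπ
  have hπapp : ∀ z, π z = L.toPoint z := fun z ↦ rfl
  -- the group `G = π⁻¹(f(M))` and the section `μ : G → M`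
  set G : AddSubgroup ℂ := f.range.comap π with hG
  have hmemG : ∀ z, z ∈ G ↔ ∃ m, f m = L.toPoint z := fun z ↦ by
    simp only [hG, AddSubgroup.mem_comap, AddMonoidHom.mem_range, hπapp]
  set μ : ℂ → M := fun z ↦ if h : ∃ m, f m = L.toPoint z then h.choose else 0 with hμ
  have hμspec : ∀ z ∈ G, f (μ z) = L.toPoint z := by
    intro z hz
    have h := (hmemG z).1 hz
    simp only [hμ, dif_pos h]
    exact h.choose_spec
  have hμadd : ∀ z ∈ G, ∀ w ∈ G, μ (z + w) = μ z + μ w := by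
    intro z hz w hw
    apply hf
    rw [map_add, hμspec z hz, hμspec w hw, hμspec (z + w) (G.add_mem hz hw)]
    exact toPoint_add_holds (L := L) z w
  -- the lift `Ψ`
  set Ψ : ℂ → ℂ := fun z ↦ (L.toPoint_surjective (f (φ (μ z)))).choose with hΨ
  have hΨspec : ∀ z, L.toPoint (Ψ z) = f (φ (μ z)) := fun z ↦
    (L.toPoint_surjective (f (φ (μ z)))).choose_spec
  have hadd : ∀ z ∈ G, ∀ w ∈ G, Ψ (z + w) - Ψ z - Ψ w ∈ L.lattice := by
    intro z hz w hw
    have h : L.toPoint (Ψ (z + w)) = L.toPoint (Ψ z + Ψ w) := by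
      rw [toPoint_add_holds (L := L), hΨspec, hΨspec, hΨspec, hμadd z hz w hw, map_add, map_add]
    have := L.toPoint_eq_toPoint_iff.1 h
    rwa [show Ψ (z + w) - (Ψ z + Ψ w) = Ψ (z + w) - Ψ z - Ψ w by ring] at this
  -- division points lie in `G`
  have hdiv : ∀ n : ℕ, 0 < n → ∀ l ∈ L.lattice, l / n ∈ G := by
    intro n hn l hl
    rw [hG, AddSubgroup.mem_comap]
    refine htors n hn _ ?_
    rw [← map_nsmul, hπapp, nsmul_eq_mul, mul_div_cancel₀ _ (by exact_mod_cast hn.ne')]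
    exact toPoint_of_mem hl
  -- the exceptional set: non-agreeing points, and points mapped to `E[2]`
  set S : Set M := {m : M | ¬ ∃ (x y : ℂ) (h : L.curve.toAffine.Nonsingular x y),
        f m = .some x y h ∧ MvPolynomial.eval ![x, y] q₁ ≠ 0 ∧ MvPolynomial.eval ![x, y] q₂ ≠ 0 ∧
        ∃ h' : L.curve.toAffine.Nonsingular
            (MvPolynomial.eval ![x, y] p₁ / MvPolynomial.eval ![x, y] q₁)
            (MvPolynomial.eval ![x, y] p₂ / MvPolynomial.eval ![x, y] q₂),
          f (φ m) = .some _ _ h'} with hS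
  have hSfin : S.Finite := halg
  have hker : (φ.ker : Set M).Finite := by
    refine hSfin.subset fun m hm ↦ ?_
    simp only [SetLike.mem_coe, AddMonoidHom.mem_ker] at hm
    rintro ⟨x, y, h, -, -, -, h', hφ⟩
    rw [hm, map_zero] at hφ
    exact (WeierstrassCurve.Affine.Point.some_ne_zero h') hφ.symm
  set E2 : Set L.curve.toAffine.Point :=
    (AddSubgroup.torsionBy L.curve.toAffine.Point ((2 : ℕ) : ℤ) : Set L.curve.toAffine.Point)
    with hE2
  have hE2fin : E2.Finite := by
    have hcard := WeierstrassCurve.card_torsionBy_eq_sq (E := L.curve) (n := 2) (by norm_num)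
    have : Finite (AddSubgroup.torsionBy L.curve.toAffine.Point ((2 : ℕ) : ℤ)) :=
      Nat.finite_of_card_ne_zero (by rw [hcard]; norm_num)
    exact Set.toFinite _
  set S₂ : Set M := S ∪ φ ⁻¹' (f ⁻¹' E2) with hS₂
  have hS₂fin : S₂.Finite :=
    hSfin.union (finite_preimage_of_finite_ker φ hker (hE2fin.preimage hf.injOn))
  -- lifts of the exceptional points to `ℂ`, and the finite set `T` of bad cosets
  set lift : L.curve.toAffine.Point → ℂ := fun P ↦ (L.toPoint_surjective P).choose with hlift
  have hliftspec : ∀ P, L.toPoint (lift P) = P := fun P ↦ (L.toPoint_surjective P).choose_spec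
  set Tset : Set ℂ := (fun m ↦ lift (f m)) '' S₂ ∪ {0} with hTset
  have hTfin : Tset.Finite := (hS₂fin.image _).union (Set.finite_singleton 0)
  set T : Finset ℂ := hTfin.toFinset with hT
  have hmemT : ∀ t, t ∈ T ↔ t ∈ Tset := fun t ↦ hTfin.mem_toFinset
  -- the rational description off `T + Λ`
  have hrat : ∀ z ∈ G, (∀ t ∈ T, z - t ∉ L.lattice) →
      z ∉ L.lattice ∧ Ψ z ∉ L.lattice ∧ ℘'[L] (Ψ z) ≠ 0 ∧
      MvPolynomial.eval ![℘[L] z, ℘'[L] z / 2] q₁ ≠ 0 ∧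
      MvPolynomial.eval ![℘[L] z, ℘'[L] z / 2] q₂ ≠ 0 ∧
      ℘[L] (Ψ z) = MvPolynomial.eval ![℘[L] z, ℘'[L] z / 2] p₁ /
        MvPolynomial.eval ![℘[L] z, ℘'[L] z / 2] q₁ ∧
      ℘'[L] (Ψ z) / 2 = MvPolynomial.eval ![℘[L] z, ℘'[L] z / 2] p₂ /
        MvPolynomial.eval ![℘[L] z, ℘'[L] z / 2] q₂ := by
    intro z hzG hzT
    have hz0 : z ∉ L.lattice := by
      have := hzT 0 ((hmemT 0).2 (Or.inr rfl))
      rwa [sub_zero] at this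
    set m₀ := μ z with hm₀
    have hm₀spec : f m₀ = L.toPoint z := hμspec z hzG
    have hm₀S₂ : m₀ ∉ S₂ := by
      intro hmem
      have ht : lift (f m₀) ∈ T := (hmemT _).2 (Or.inl ⟨m₀, hmem, rfl⟩)
      apply hzT _ ht
      apply L.toPoint_eq_toPoint_iff.1
      rw [hliftspec, hm₀spec]
    have hm₀S : m₀ ∉ S := fun h ↦ hm₀S₂ (Or.inl h)
    have hm₀E2 : f (φ m₀) ∉ E2 := fun h ↦ hm₀S₂ (Or.inr h)
    simp only [hS, mem_setOf_eq, not_not] at hm₀S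
    obtain ⟨x, y, hxy, hfm, hq₁, hq₂, h', hfφ⟩ := hm₀S
    rw [hm₀spec, toPoint_of_notMem hz0] at hfm
    obtain ⟨rfl, rfl⟩ : x = ℘[L] z ∧ y = ℘'[L] z / 2 :=
      WeierstrassCurve.Affine.Point.some.inj hfm.symm
    have hΨz' : L.toPoint (Ψ z) = f (φ m₀) := by rw [hm₀]; exact hΨspec z
    have hΨz := hΨz'
    rw [hfφ] at hΨz
    have hΨ0 : Ψ z ∉ L.lattice := by
      intro hmem
      rw [toPoint_of_mem hmem] at hΨz
      exact (WeierstrassCurve.Affine.Point.some_ne_zero h') hΨz.symm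
    rw [toPoint_of_notMem hΨ0] at hΨz
    obtain ⟨h℘, h℘'⟩ := WeierstrassCurve.Affine.Point.some.inj hΨz
    refine ⟨hz0, hΨ0, fun h0 ↦ hm₀E2 ?_, hq₁, hq₂, h℘, h℘'⟩
    -- `℘'(Ψ z) = 0` would make `f (φ m₀) = π (Ψ z)` a `2`-torsion point
    have hP : L.toPoint (Ψ z) = -L.toPoint (Ψ z) := by
      rw [toPoint_of_notMem hΨ0, WeierstrassCurve.Affine.Point.neg_some]
      simp only [WeierstrassCurve.Affine.negY, WeierstrassCurve.toAffine, curve_a₁, curve_a₃]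
      congr 1
      rw [h0]; ring
    rw [hE2, SetLike.mem_coe, AddSubgroup.torsionBy.nsmul_iff, ← hΨz', two_nsmul,
      add_eq_zero_iff_eq_neg]
    exact hP
  -- the analytic core
  obtain ⟨α, hα⟩ :=
    L.exists_forall_sub_mul_mem_lattice_of_rational_lift G hdiv Ψ hadd p₁ q₁ p₂ q₂ T hrat
  refine ⟨α, fun m z hmz ↦ ?_⟩
  have hzG : z ∈ G := (hmemG z).2 ⟨m, hmz⟩
  have hμz : μ z = m := hf (by rw [hμspec z hzG, hmz])
  have h1 : L.toPoint (Ψ z) = L.toPoint (α * z) := L.toPoint_eq_toPoint_iff.2 (hα z hzG)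
  rw [← hμz, ← hΨspec z, h1]

end PeriodPair

end
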